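import Mathlib
import Literature.NumberTheory.LFunctions.Zhang2022.SkeletonObjects
import Literature.NumberTheory.LFunctions.Zhang2022.Section10Defs
import HarnessLib

/-!
# Zhang (2022), typed skeleton III: the named propositions — Propositions 2.1–2.6, Lemma 2.3,
# Lemma 5.7, (2.32), (2.33), (8.23), (9.7), (10.17), (11.1), (18.1), (18.3), and the standard
# facts the assembly consumes

Topic `Literature/NumberTheory/LFunctions/Zhang2022` (Landau–Siegel audit tree; verdict-neutral).
Y. Zhang, *Discrete mean estimates and the Landau–Siegel zero*, arXiv:2211.02515v1 (2022)
[Zhang2022LandauSiegel] — **an unrefereed manuscript under adjudication. Every `def … : Prop` below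
is a CLAIM OF THE MANUSCRIPT, STATED (as a named hypothesis for `SkeletonAssembly`), NOT ASSERTED**,
except the two items marked standard (`ZerosFinite` — proved in `SkeletonAssembly`; `PsiChiPrimitive`
— primitivity of a product of primitive characters to coprime moduli, not proved here) and the
nodes `Lemma57`, `FrakALowerBound`, which `SkeletonAssembly` discharges from tree theorems. Each node
carries its locator; the adjudication cell maps referee gap-ledger items to these names.

Quantifier convention. The manuscript works with "`D` greater than a sufficiently large and
effectively computable number", a real primitive `χ (mod D)`, and (from §5 on) under Assumption
(A). `ForAllLarge S` := `∃ D₀, ∀ D ≥ D₀, ∀ χ (mod D) real primitive, S D χ`; a printed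
"`X = c𝔞𝔓 + o(𝔓)`" is typed as `∀ ε > 0, ForAllLarge (… |X − c𝔞𝔓| ≤ ε𝔓)`, a printed "`X ≪ Y`" as
`∃ C, ForAllLarge (… X ≤ C·Y)`. The unspecified "(large) constant" `c′` of (2.13) is a parameter of
every node that involves `β₁, β₂, β₃` (through `𝔠*`).

| node | locator | printed claim |
|---|---|---|
| `Prop21` | §2 Prop. 2.1 (proof §3) | (A) ⇒ `#Ψ₂ ≪ 𝔓𝓛⁻⁷³⁹` |
| `Prop22i/ii/iii c′`, `Prop22` | §2 Prop. 2.2 (proof §4) | `ψ ∈ Ψ₁` ⇒ zeros of `L(s,ψ)L(s,ψχ)` in `Ω` are on `σ = ½`, simple, with gaps `α + O(α²𝓛)` (restated p. 5 with `c′`) |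
| `Lemma23 c′` | §2 Lemma 2.3 (proof p. 6) | `ψ ∈ Ψ₁`, `ρ ∈ 𝔷(ψ)` ⇒ `𝔠*(ρ,ψ) ≥ 0` (real by (2.11)–(2.12)) |
| `Prop24 c′`, `Prop25 c′`, `Prop26 c′` | §2 Props. 2.4–2.6 (proofs §10, §18, §11) | (A) ⇒ `|Ξ₁*| > 5𝔞𝔓`, `Ξ₂* < 2𝔞𝔓`, `Ξ₃* = o(𝔞𝔓)` |
| `Ineq232 c′`, `Ineq233 c′` | §2 (2.32), (2.33) (proofs §18) | (A) ⇒ `Ξ₁ < 0.001𝔞𝔓`, `Ξ_J < 3000𝔞𝔓` |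
| `Lemma57`, `FrakALowerBound` | §5 Lemma 5.7; §2 p. 6 | (A) ⇒ `L′(1,χ) ≫ D/φ(D)`; (A) ⇒ `𝔞 ≫ 1` |
| `Eval823 c′`, `Eval97 c′`, `Eval181 c′` | (8.23), (9.7), (18.1) | `Ξ₁₁ = 𝔠₁𝔞𝔓 + o(𝔓)`, `Ξ₁₂ = 𝔠₂𝔞𝔓 + o(𝔓)`, `Ξ₁₃ = 𝔠₃𝔞𝔓 (+o(𝔓))` |
| `Margin232` | §18 p. 36 | `𝔠₁ + 𝔠₂ + 2Re 𝔠₃ < 0.001` ("from (8.24), (9.8), (18.2)") |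
| `Eval1017 c′` | (10.17) | `Ξ₁* = (𝔡′ + 𝔡)𝔞𝔓 + o(𝔓)` (with the tree's `Prop24Main`: `|𝔡′+𝔡| > 5`) |
| `Bound183 c′` | (18.3) + §18 p. 36–37 | `Ξ_J = 2Re Θ₁(𝐚₂₃,𝐚₂₃) + o(𝔓) ≤ (8800/π)𝔞𝔓 + o(𝔓)` |
| `Eval111 c′` | (11.1) | `ΣΣ𝔠*|J₁ − ZJ̄₂|²ω = o(𝔞𝔓)` |
| `ZerosFinite`, `PsiChiPrimitive` | standard | `𝔷(ψ)` finite; `ψχ` primitive mod `Dp` |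

Deliberately NOT here (later skeleton files): the inner nodes of §§3–7 and §§12–17 (Lemmas 3.1–6.1,
Proposition 7.1, Lemma 8.1, Proposition 14.1, Lemmas 15.1–17.1, Appendices A–B), i.e. the DAG
below the evaluation nodes. The tree's numerical nodes (8.24) `Ineq824`, (9.8) `Ineq98`, (18.2)
`Ineq182`, `Prop24Main`, `Ineq233` (with certificates) are imported, not restated.

## References

* Y. Zhang, arXiv:2211.02515v1 (2022), §2 (Props. 2.1–2.6, Lemma 2.3, (2.32)–(2.33)), §3 p. 7,
  §5 Lemma 5.7, §8 (8.23), §9 (9.7), §10 (10.17), §11 (11.1), §18 (18.1)–(18.3).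
  [cite: Zhang2022LandauSiegel, §§2–18]
-/

noncomputable section

open Complex Real ComplexConjugate

namespace Literature.NumberTheory.LFunctions.Zhang2022.Skeleton

/-! ## The standing quantifier -/

/-- **"`D` greater than a sufficiently large and effectively computable number"** (§2 p. 4) over
real primitive characters: `ForAllLarge S` says `S D χ` holds for every real (quadratic) primitive
character `χ` to every modulus `D ≥ D₀`, for some `D₀`. [cite: Zhang2022LandauSiegel, §2 p. 4] -/
def ForAllLarge (S : (D : ℕ) → [NeZero D] → DirichletCharacter ℂ D → Prop) : Prop :=
  ∃ D₀ : ℕ, ∀ (D : ℕ) [NeZero D] (χ : DirichletCharacter ℂ D),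
    D₀ ≤ D → χ.IsQuadratic → χ.IsPrimitive → S D χ

/-- Two eventual statements hold eventually together (take the larger `D₀`).
[cite: Zhang2022LandauSiegel, §2 p. 4] -/
theorem ForAllLarge.and {S T : (D : ℕ) → [NeZero D] → DirichletCharacter ℂ D → Prop}
    (hS : ForAllLarge S) (hT : ForAllLarge T) : ForAllLarge fun D _ χ => S D χ ∧ T D χ := by
  obtain ⟨D₁, h₁⟩ := hS
  obtain ⟨D₂, h₂⟩ := hT
  exact ⟨max D₁ D₂, fun D _ χ hD hq hp =>
    ⟨h₁ D χ (le_trans (le_max_left _ _) hD) hq hp, h₂ D χ (le_trans (le_max_right _ _) hD) hq hp⟩⟩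

/-- Monotonicity of the standing quantifier. [cite: Zhang2022LandauSiegel, §2 p. 4] -/
theorem ForAllLarge.mono {S T : (D : ℕ) → [NeZero D] → DirichletCharacter ℂ D → Prop}
    (hS : ForAllLarge S)
    (hST : ∀ (D : ℕ) [NeZero D] (χ : DirichletCharacter ℂ D), χ.IsQuadratic → χ.IsPrimitive →
      S D χ → T D χ) :
    ForAllLarge T := by
  obtain ⟨D₀, h⟩ := hS
  exact ⟨D₀, fun D _ χ hD hq hp => hST D χ hq hp (h D χ hD hq hp)⟩

/-- An eventual statement may also assume `D ≥ D₁` for any fixed `D₁`. [cite: Zhang2022LandauSiegel, §2 p. 4] -/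
theorem ForAllLarge.of_le {S : (D : ℕ) → [NeZero D] → DirichletCharacter ℂ D → Prop} (D₁ : ℕ)
    (h : ∀ (D : ℕ) [NeZero D] (χ : DirichletCharacter ℂ D), D₁ ≤ D → χ.IsQuadratic →
      χ.IsPrimitive → S D χ) : ForAllLarge S :=
  ⟨D₁, fun D _ χ hD hq hp => h D χ hD hq hp⟩

variable (c' : ℝ)

/-! ## §2: Propositions 2.1, 2.2 and Lemma 2.3 -/

/-- **Proposition 2.1** (§2 p. 4; proof: §3, Lemmas 3.1–3.6): "Let `Ψ₂` be the complement of `Ψ₁`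
in `Ψ`. If (A) holds, then `Σ_{ψ∈Ψ₂} 1 ≪ 𝔓𝓛⁻⁷³⁹`." CLAIM, stated not asserted.
[cite: Zhang2022LandauSiegel, §2 Prop. 2.1] -/
def Prop21 : Prop :=
  ∃ C : ℝ, ForAllLarge fun D _ χ => AssumptionA D χ →
    ((PsiTwo χ).ncard : ℝ) ≤ C * frakP D * (ell D ^ 739)⁻¹

/-- **Proposition 2.2 (i)** (§2 p. 4; proof §4, Lemmas 4.5–4.6): for `ψ ∈ Ψ₁`, "all the zeros of
`L(s,ψ)L(s,ψχ)` in `Ω` lie on the critical line." CLAIM. [cite: Zhang2022LandauSiegel, §2 Prop. 2.2 (i)] -/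
def Prop22i : Prop :=
  ForAllLarge fun _ _ χ => ∀ x ∈ PsiOne χ, ∀ s ∈ prodZeroSetOmega χ x, s.re = 1 / 2

/-- **Proposition 2.2 (ii)** (proof §4, Lemma 4.6): for `ψ ∈ Ψ₁`, "all the zeros of `L(s,ψ)L(s,ψχ)`
in `Ω` are simple." CLAIM. [cite: Zhang2022LandauSiegel, §2 Prop. 2.2 (ii)] -/
def Prop22ii : Prop :=
  ForAllLarge fun _ _ χ => ∀ x ∈ PsiOne χ, ∀ s ∈ prodZeroSetOmega χ x,
    deriv (fun w => x.ψ.LFunction w * (psiChi χ x).LFunction w) s ≠ 0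

/-- **Proposition 2.2 (iii)** in its restated form (§2 p. 5; proof §4, Lemmas 4.6–4.7): for `ψ ∈ Ψ₁`
and consecutive zeros `½ + iγ`, `½ + iγ′` (`γ′ > γ`) of `L(s,ψ)L(s,ψχ)` in `Ω`,
"`|γ′ − γ − α| < c′α²𝓛`" for "some (large) constant `c′ > 0`" — here the parameter `c'`.
CLAIM. [cite: Zhang2022LandauSiegel, §2 Prop. 2.2 (iii), p. 5] -/
def Prop22iii : Prop :=
  ForAllLarge fun D _ χ => ∀ x ∈ PsiOne χ, ∀ s ∈ prodZeroSetOmega χ x, ∀ s' ∈ prodZeroSetOmega χ x,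
    s.im < s'.im → (∀ s'' ∈ prodZeroSetOmega χ x, ¬ (s.im < s''.im ∧ s''.im < s'.im)) →
      |s'.im - s.im - alpha D| < c' * alpha D ^ 2 * ell D

/-- **Proposition 2.2** (§2 p. 4): (i) ∧ (ii) ∧ (iii). CLAIM. [cite: Zhang2022LandauSiegel, §2 Prop. 2.2] -/
def Prop22 : Prop := Prop22i ∧ Prop22ii ∧ Prop22iii c'

/-- **Lemma 2.3** (§2 p. 5; proof p. 6 from Prop. 2.2): "Suppose `ψ ∈ Ψ₁` and `ρ ∈ 𝔷(ψ)`. Then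
`𝔠*(ρ,ψ) ≥ 0`" (with "`𝔠*(ρ,ψ) ∈ ℝ`" by (2.11)–(2.12)). CLAIM.
[cite: Zhang2022LandauSiegel, §2 Lemma 2.3] -/
def Lemma23 : Prop :=
  ForAllLarge fun D _ χ => ∀ x ∈ PsiOne χ, ∀ ρ ∈ zeroSet D x,
    (cstar c' D x ρ).im = 0 ∧ 0 ≤ (cstar c' D x ρ).re

/-! ## §2: Propositions 2.4–2.6, (2.32), (2.33) -/

/-- **Proposition 2.4** (§2 p. 6; proof §10): "Assume that (A) holds. Then `|Ξ₁*| > 5𝔞𝔓`." CLAIM.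
[cite: Zhang2022LandauSiegel, §2 Prop. 2.4] -/
def Prop24 : Prop :=
  ForAllLarge fun D _ χ => AssumptionA D χ → 5 * frakA χ * frakP D < ‖xiStar1 c' χ‖

/-- **Proposition 2.5** (§2 p. 6; proof §18): "Assume that (A) holds. Then `Ξ₂* < 2𝔞𝔓`." CLAIM.
[cite: Zhang2022LandauSiegel, §2 Prop. 2.5] -/
def Prop25 : Prop :=
  ForAllLarge fun D _ χ => AssumptionA D χ → xiStar2 c' χ < 2 * frakA χ * frakP D

/-- **Proposition 2.6** (§2 p. 6; proof §11): "Assume that (A) holds. Then `Ξ₃* = o(𝔞𝔓)`", typed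
as: for every `ε > 0`, eventually `Ξ₃* ≤ ε𝔞𝔓`. CLAIM. [cite: Zhang2022LandauSiegel, §2 Prop. 2.6] -/
def Prop26 : Prop :=
  ∀ ε : ℝ, 0 < ε → ForAllLarge fun D _ χ => AssumptionA D χ →
    xiStar3 c' χ ≤ ε * frakA χ * frakP D

/-- **(2.32)** (§2 p. 6; proof §18): under (A), `ΣΣ𝔠*|H₁ + ZH̄₂|²ω < 0.001𝔞𝔓`. CLAIM.
[cite: Zhang2022LandauSiegel, §2 (2.32)] -/
def Ineq232 : Prop :=
  ForAllLarge fun D _ χ => AssumptionA D χ → xi1 c' χ < 0.001 * frakA χ * frakP D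

/-- **(2.33)** (§2 p. 6; proof §18): under (A), `ΣΣ𝔠*|J₁|²ω < 3000𝔞𝔓`. CLAIM.
[cite: Zhang2022LandauSiegel, §2 (2.33)] -/
def Ineq233 : Prop :=
  ForAllLarge fun D _ χ => AssumptionA D χ → xiJ c' χ < 3000 * frakA χ * frakP D

/-! ## §5: Lemma 5.7 and `𝔞 ≫ 1` -/

/-- **Lemma 5.7** (§5 p. 11, under (A)): "`L′(1,χ) ≫ D/φ(D)`" (`L′(1,χ)` is real for real `χ`;
stated for its real part). CLAIM. [cite: Zhang2022LandauSiegel, §5 Lemma 5.7] -/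
def Lemma57 : Prop :=
  ∃ c : ℝ, 0 < c ∧ ForAllLarge fun D _ χ => AssumptionA D χ →
    c * ((D : ℝ) / Nat.totient D) ≤ (deriv χ.LFunction 1).re

/-- **"`(A)` implies `𝔞 ≫ 1` (see Lemma 5.7)"** (§2 p. 6): the form in which Lemma 5.7 is consumed
(it turns every `o(𝔓)` into `o(𝔞𝔓)`). CLAIM. [cite: Zhang2022LandauSiegel, §2 p. 6] -/
def FrakALowerBound : Prop :=
  ∃ a₀ : ℝ, 0 < a₀ ∧ ForAllLarge fun D _ χ => AssumptionA D χ → a₀ ≤ frakA χ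

/-! ## §§8, 9, 18: the evaluations of `Ξ₁₁`, `Ξ₁₂`, `Ξ₁₃` and the printed margin -/

/-- **(8.23)** (§8 p. 18; from Lemma 8.1, Prop. 7.1, Lemmas 8.2–8.4, (8.10)–(8.22)):
"`Ξ₁₁ = 𝔠₁𝔞𝔓 + o(𝔓)`", `𝔠₁ = c₁₁ + ι₂c₂₁ + ῑ₂c₁₂ + |ι₂|²c₂₂` (the tree's `frakc1`, real). CLAIM.
[cite: Zhang2022LandauSiegel, §8 (8.23)] -/
def Eval823 : Prop :=
  ∀ ε : ℝ, 0 < ε → ForAllLarge fun D _ χ => AssumptionA D χ →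
    |xi11 c' χ - frakc1.re * frakA χ * frakP D| ≤ ε * frakP D

/-- **(9.7)** (§9 p. 19; same route with `𝐚₁₂, 𝐚₂₂`): "`Ξ₁₂ = 𝔠₂𝔞𝔓 + o(𝔓)`",
`𝔠₂ = |ι₃|²c₃₃ + ι₃ῑ₄c₃₄ + ι₄ῑ₃c₄₃ + |ι₄|²c₄₄` (the tree's `frakc2`). CLAIM.
[cite: Zhang2022LandauSiegel, §9 (9.7)] -/
def Eval97 : Prop :=
  ∀ ε : ℝ, 0 < ε → ForAllLarge fun D _ χ => AssumptionA D χ →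
    |xi12 c' χ - frakc2.re * frakA χ * frakP D| ≤ ε * frakP D

/-- **(18.1)** (§18 p. 36; from (12.3), (12.17), (13.7), (15.24), (16.17), (17.10)):
"`Ξ₁₃ = 𝔠₃𝔞𝔓`", `𝔠₃ = −i(3𝔢₁ + 3𝔢₂ + 𝔢₃ + 𝔢₀) + e₁* + 2e₂* + ε` — the tree's `frakc3` is the
explicit part; the printed `ε` is a ROUNDING term, "`|ε| < 10⁻⁵`, not necessarily the same in each
occurrence" (§8 p. 18), inherited from (12.17), and is typed as the slack `10⁻⁵·𝔞𝔓`; the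
suppressed `o(𝔓)` as `ε′𝔓`. CLAIM. [cite: Zhang2022LandauSiegel, §18 (18.1)] -/
def Eval181 : Prop :=
  ∀ ε : ℝ, 0 < ε → ForAllLarge fun D _ χ => AssumptionA D χ →
    ‖xi13 c' χ - frakc3 * frakA χ * frakP D‖ ≤ 1e-5 * frakA χ * frakP D + ε * frakP D

/-- **The printed margin of §18** (p. 36): "It follows from (8.24), (9.8) and (18.2) that
`𝔠₁ + 𝔠₂ + 2Re{𝔠₃} < 0.001`", for `𝔠₃ =` the explicit `frakc3` of (18.1) plus its rounding term
`|ε| < 10⁻⁵` (worst case); the tree's `Ineq18sum` is the same sentence for the reduced `𝔠₃` of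
(18.2) (`frakc3r`, without `ε`), and `Ineq824`, `Ineq98`, `Ineq182` are the three printed inputs.
CLAIM. [cite: Zhang2022LandauSiegel, §18 p. 36] -/
def Margin232 : Prop := frakc1.re + frakc2.re + 2 * (frakc3.re + 1e-5) < 0.001

/-! ## §10: the evaluation of `Ξ₁*` -/

/-- **(10.17)** (§10 p. 23; from (10.1), Lemma 8.1, Prop. 7.1, Lemmas 10.1–10.2, (10.12)–(10.16)):
"`Ξ₁* = (𝔡′ + 𝔡)𝔞𝔓 + o(𝔓)`" (the tree's `dprime`, `dfrak`; Prop. 2.4 then needs `|𝔡′ + 𝔡| > 5`,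
the tree's `Prop24Main`, argued in print as `Re 𝔡′ > 5.1`, `|Re 𝔡| < 0.1`). CLAIM.
[cite: Zhang2022LandauSiegel, §10 (10.17)] -/
def Eval1017 : Prop :=
  ∀ ε : ℝ, 0 < ε → ForAllLarge fun D _ χ => AssumptionA D χ →
    ‖xiStar1 c' χ - (dprime + dfrak) * frakA χ * frakP D‖ ≤ ε * frakP D

/-! ## §18: the bound for `Ξ_J`, and §11: the mean square of `J₁ − ZJ̄₂` -/

/-- **(18.3) with the crude bound of §18** (p. 36–37): "`ΣΣ𝔠*|J₁|²ω = 2Re{Θ₁(𝐚₂₃,𝐚₂₃)} + o(𝔓)`"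
and "`Re{(1/2α)S₁ + (2/α)S₂ + (3/2α)S₃} < 4400𝔞/π`", whence by Prop. 7.1 `Ξ_J ≤ (8800/π)𝔞𝔓 + o(𝔓)`.
CLAIM. [cite: Zhang2022LandauSiegel, §18 (18.3)] -/
def Bound183 : Prop :=
  ∀ ε : ℝ, 0 < ε → ForAllLarge fun D _ χ => AssumptionA D χ →
    xiJ c' χ ≤ 8800 / π * frakA χ * frakP D + ε * frakP D

variable {D : ℕ} [NeZero D] (χ : DirichletCharacter ℂ D) in
/-- The mean square `ΣΣ𝔠*(ρ,ψ)|J₁(ρ,ψ) − Z(ρ,ψχ)J̄₂(ρ,ψ)|²ω(ρ)` of (11.1) (there written with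
`J₂(1−ρ,ψ̄) = J̄₂(ρ,ψ)` on the critical line, §10 p. 20). [cite: Zhang2022LandauSiegel, §11 (11.1)] -/
def xi3sq : ℝ := ∑ i ∈ idx χ, (cstar c' D i.1 i.2).re *
  ‖J1 χ i.1 i.2 - Zpc χ i.1 i.2 * conj (J2 χ i.1 i.2)‖ ^ 2 * (omegaW D i.2).re

/-- **(11.1)** (§11 p. 23; from Lemmas 11.1–11.2 and the mean-value bounds cited as "(8.25),
(8.26)"): "`ΣΣ𝔠*|J₁ − ZJ₂(1−ρ,ψ̄)|²ω = o(𝔞𝔓)`". CLAIM. [cite: Zhang2022LandauSiegel, §11 (11.1)] -/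
def Eval111 : Prop :=
  ∀ ε : ℝ, 0 < ε → ForAllLarge fun D _ χ => AssumptionA D χ →
    xi3sq c' χ ≤ ε * frakA χ * frakP D

/-! ## Standard facts consumed by the assembly (discharged or dischargeable) -/

/-- **`𝔷(ψ)` is finite**: the zeros of the entire, not identically vanishing function `L(·,ψ)`
(`ψ` primitive, non-principal) in the bounded box (2.14) form a finite set. Standard (isolated
zeros); stated as the hypothesis that makes the `Finset` sums of `SkeletonObjects` the printed sums.
[cite: Zhang2022LandauSiegel, §2 (2.14)] -/
def ZerosFinite : Prop := ∀ (D : ℕ) (x : Chr D), (zeroSet D x).Finite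

/-- **"`χψ` is a primitive character (mod `Dp`)"** (§4 p. 8): for `D ≥ 3` the prime `p ∼ P`
exceeds `D`, so `χ (mod D)` and `ψ (mod p)` primitive have coprime conductors and `ψχ` is
primitive to the modulus `Dp`. Standard. [cite: Zhang2022LandauSiegel, §4 p. 8] -/
def PsiChiPrimitive : Prop :=
  ∀ (D : ℕ) [NeZero D] (χ : DirichletCharacter ℂ D) (x : Chr D),
    3 ≤ D → χ.IsPrimitive → (psiChi χ x).IsPrimitive

end Literature.NumberTheory.LFunctions.Zhang2022.Skeleton
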